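import Mathlib.AlgebraicGeometry.AlgClosed.Basic
import Mathlib.CategoryTheory.Limits.Shapes.Pullback.Iso
import Literature.AlgebraicGeometry.Motives.AbelianVarietyChartDivisor
import Literature.AlgebraicGeometry.Motives.AffineSpaceDivisor
import HarnessLib

/-!
# Abelian varieties are projective (Görtz–Wedhorn II, Thm. 27.71 / Prop. 27.174), without cohomology

The quasi-projectivity argument of Görtz–Wedhorn II, Thm. 27.71 (Steps (III)–(IV); Stacks 0BF7),
carried out for an abelian variety `A` over an algebraically closed field `k` with the bricks
`Motives/FiniteFlatChart` (a finite flat chart `π : W → D(h) ⊆ 𝔸ˢ_k` of an affine open `U`),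
`Motives/AbelianVarietyChartFamily` (the incidence scheme `WA`, the action, the sections at
rational points), `Motives/AbelianVarietyChartDivisor` (the effective Cartier divisor `𝓓` on
`𝔸ˢ_A` swept out by `act^* E`, `Supp E = A ∖ U`) and `Motives/AffineSpaceDivisor` (restrictions
of `𝓓` along two constant sections of `𝔸ˢ_A → A` are linearly equivalent — Prop. 27.69 /
Lemma 27.70 in divisor form):

* `ChartFamily.avoids_sv_iff` — **the fibres of `Supp 𝓓`**: for a rational point `v = π(g)`,
  `s_v(x) ∉ Supp 𝓓 ⇔ g' · x ∈ U` for all `g' ∈ π⁻¹(v)` (uniqueness of points of fibre products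
  over rational points; closed points of the finite fibres are rational);
* `ChartFamily.exists_good_point` — for a closed point `x₀` there is `v` with `s_v(x₀) ∉ Supp 𝓓`
  (`π(W ∖ W x₀⁻¹ U)` is a proper closed subset of `D(h)`: only the generic point of `W` maps to the
  generic point, `π` being finite);
* `AbelianVariety.exists_isAmple_of_chart` — **`D = s_{v₀}^* 𝓓` is ample**: `s_v^*𝓓 ∼ D`
  (`AffineSpaceDivisor.pullbackAvoiding_section_linEquiv`), `x₀ ∉ Supp s_v^*𝓓` and
  `A ∖ Supp s_v^*𝓓 = ⋂_{g' ∈ π⁻¹(v)} t_{g'}⁻¹ U` is affine;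
* `AbelianVariety.isProjectiveOver_self`, **`AbelianVariety.isProjectiveOver_holds`** — every
  abelian variety over every field is projective (`isProjectiveOver_of_isAmple`, then descent from
  `k̄`, `isProjectiveOver_of_algebraicClosure`): the DISCHARGE of the named fact
  `AbelianVariety.isProjectiveOver` (`Motives/CyclesAbelianVarieties`), hitherto resting on the
  finiteness of coherent cohomology (`cechComplex_pseudoCoherent_general`) through the theorem of
  the cube; also `AbelianVariety.isSmoothProjective_holds`.

Everything is proved; no named facts.

## References

* U. Görtz, T. Wedhorn, *Algebraic Geometry II: Cohomology of Schemes*, Springer Spektrum (2023),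
  doi:10.1007/978-3-658-43031-3: Thm. 27.71, proof, Steps (III)–(IV), pp. 828–829; Prop. 27.174
  (p. 880). [GortzWedhorn2023]
* The Stacks project, Tag 0BF7. [StacksProject]
* D. Mumford, *Abelian Varieties* (1970): §6, Application 1, p. 62. [MumfordAV1970]
-/

universe u

open CategoryTheory CategoryTheory.Limits AlgebraicGeometry TopologicalSpace Opposite
open Literature.AlgebraicGeometry.Motives.RatFn
open scoped MonObj

noncomputable section

namespace Literature.AlgebraicGeometry.Motives

set_option backward.isDefEq.respectTransparency false

namespace ChartFamily

/-! ### Points of fibre products over rational points -/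

section PullbackPoints

variable {X Y S : Scheme.{u}} {f : X ⟶ S} {g : Y ⟶ S}

/-- `κ(x) ⊗_{κ(s)} κ(y)` has exactly one prime when `κ(s) → κ(x)` is surjective (then it is
`κ(y)`). [folklore] -/
theorem subsingleton_Spec_tensor (T : Scheme.Pullback.Triplet f g)
    (hsurj : Function.Surjective (f.residueFieldMap T.x)) : Subsingleton ↥(Spec T.tensor) := by
  set a := (S.residueFieldCongr T.hx).inv ≫ f.residueFieldMap T.x with ha
  set b := (S.residueFieldCongr T.hy).inv ≫ g.residueFieldMap T.y with hb
  haveI : IsIso (f.residueFieldMap T.x) := by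
    rw [ConcreteCategory.isIso_iff_bijective]
    exact ⟨(f.residueFieldMap T.x).hom.injective, hsurj⟩
  haveI : IsIso a := by rw [ha]; infer_instance
  haveI : IsIso (pushout.inr a b) := pushout_inr_iso_of_left_iso a b
  let e : T.tensor ≅ Y.residueField T.y := (asIso (pushout.inr a b)).symm
  let e' : PrimeSpectrum (Y.residueField T.y) ≃ PrimeSpectrum T.tensor :=
    (PrimeSpectrum.comapEquiv e.commRingCatIsoToRingEquiv.symm).toEquiv
  haveI : Subsingleton (PrimeSpectrum (Y.residueField T.y)) := inferInstance
  exact (e'.symm.subsingleton : Subsingleton (PrimeSpectrum T.tensor))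

/-- **Points of a fibre product with the same projections coincide when the residue field
extension `κ(f x) → κ(x)` at the first projection is trivial** (the fibre of
`X ×_S Y → X × Y` over `(x, y)` is `Spec (κ(x) ⊗_{κ(s)} κ(y))`; Mathlib
`Scheme.Pullback.carrierEquiv`). [folklore] -/
theorem pullback_ext_of_surjective_residueFieldMap {t₁ t₂ : ↥(pullback f g)}
    (h₁ : pullback.fst f g t₁ = pullback.fst f g t₂) (h₂ : pullback.snd f g t₁ = pullback.snd f g t₂)
    (hsurj : Function.Surjective (f.residueFieldMap (pullback.fst f g t₂))) : t₁ = t₂ := by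
  apply Scheme.Pullback.carrierEquiv.injective
  rw [Scheme.Pullback.carrierEquiv_eq_iff]
  refine ⟨Scheme.Pullback.Triplet.ext h₁ h₂, ?_⟩
  haveI : Subsingleton ↥(Spec (Scheme.Pullback.carrierEquiv t₂).fst.tensor) :=
    subsingleton_Spec_tensor (Scheme.Pullback.Triplet.ofPoint t₂) hsurj
  exact Subsingleton.elim _ _

end PullbackPoints

/-! ### Closed points over an algebraically closed field -/

section ClosedPoints

variable {k : Type u} [Field k] [IsAlgClosed k] {T T' : Scheme.{u}}

/-- **At a closed point of a `k`-scheme locally of finite type (`k` algebraically closed) every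
`k`-morphism induces a surjection on residue fields** (`κ(t) = k`, Hilbert's Nullstellensatz;
Mathlib `residueFieldIsoBase`). [folklore] -/
theorem surjective_residueFieldMap_of_isClosed (h : T ⟶ Spec (.of k)) [LocallyOfFiniteType h]
    (h' : T' ⟶ Spec (.of k)) (φ : T ⟶ T') (hφ : φ ≫ h' = h) {t : T}
    (ht : IsClosed ({t} : Set T)) : Function.Surjective (φ.residueFieldMap t) := by
  let e := residueFieldIsoBase h t ht
  set pre' := Spec.preimage (T'.fromSpecResidueField (φ t) ≫ h') with hpre'
  have h2 : Spec.map (pre' ≫ φ.residueFieldMap t) = Spec.map e.inv := by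
    rw [Spec.map_comp, hpre', Spec.map_preimage, SpecMap_residueFieldIsoBase_inv, ← hφ,
      Scheme.Hom.SpecMap_residueFieldMap_fromSpecResidueField_assoc]
  have h3 : pre' ≫ φ.residueFieldMap t = e.inv := Spec.map_injective h2
  have hbij : Function.Bijective (pre' ≫ φ.residueFieldMap t).hom := by
    rw [h3]; exact ConcreteCategory.bijective_of_isIso e.inv
  rw [CommRingCat.hom_comp, RingHom.coe_comp] at hbij
  exact Function.Surjective.of_comp hbij.2

omit [IsAlgClosed k] in
/-- **A point of a finite fibre over a closed point of a Jacobson space is closed**: its closure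
is finite, so the point is locally closed, hence closed (Mathlib
`isClosed_singleton_of_isLocallyClosed_singleton`). [folklore] -/
theorem isClosed_singleton_of_finite_fiber [JacobsonSpace T] (f : T ⟶ T') {t : T}
    (hfin : (f ⁻¹' {f t}).Finite) (hcl : IsClosed ({f t} : Set T')) :
    IsClosed ({t} : Set T) := by
  apply isClosed_singleton_of_isLocallyClosed_singleton
  have hsub : closure ({t} : Set T) ⊆ f ⁻¹' {f t} := by
    intro z hz
    have hs : t ⤳ z := specializes_iff_mem_closure.2 hz
    have hz' : f z ∈ closure ({f t} : Set T') := specializes_iff_mem_closure.1 (hs.map f.continuous)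
    rw [hcl.closure_eq] at hz'
    exact hz'
  have hfin' : (closure ({t} : Set T)).Finite := hfin.subset hsub
  set F := closure ({t} : Set T) \ {t} with hF
  have hFfin : F.Finite := hfin'.subset fun _ h => h.1
  have hclosedU : IsClosed (⋃ z ∈ F, closure ({z} : Set T)) :=
    hFfin.isClosed_biUnion fun z _ => isClosed_closure
  have heq : ({t} : Set T) = closure {t} ∩ (⋃ z ∈ F, closure ({z} : Set T))ᶜ := by
    ext y
    constructor
    · rintro rfl
      refine ⟨subset_closure rfl, ?_⟩
      rw [Set.mem_compl_iff, Set.mem_iUnion₂]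
      rintro ⟨z, ⟨hz, hzt⟩, hyz⟩
      have h1 : z ⤳ y := specializes_iff_mem_closure.2 hyz
      have h2 : y ⤳ z := specializes_iff_mem_closure.2 hz
      exact hzt ((h1.antisymm h2).eq ▸ rfl)
    · rintro ⟨hy, hyU⟩
      by_contra hne
      apply hyU
      rw [Set.mem_iUnion₂]
      exact ⟨y, ⟨hy, hne⟩, subset_closure rfl⟩
  rw [heq]
  exact isClosed_closure.isLocallyClosed.inter hclosedU.isOpen_compl.isLocallyClosed

end ClosedPoints

/-! ### Rational points of `W` and the fibres of `π` -/

variable {k : Type u} [Field k] [IsAlgClosed k] (A : AbelianVariety k)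
  (c : FiniteFlatChart k A.X.left A.X.hom)

/-- The structure morphism `W → Spec k`. [folklore] -/
abbrev fW : (c.W : Scheme.{u}) ⟶ Spec (.of k) := c.W.ι ≫ A.X.hom

omit [IsAlgClosed k] in
/-- `A` is Jacobson. [folklore] -/
instance jacobsonSpace_A : JacobsonSpace A.X.left := A.jacobsonSpace_left

omit [IsAlgClosed k] in
/-- `W` is Jacobson. [folklore] -/
instance jacobsonSpace_W : JacobsonSpace (c.W : Scheme.{u}) :=
  .of_isOpenEmbedding c.W.ι.isOpenEmbedding

omit [IsAlgClosed k] in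
/-- A closed point of `W` is closed in `A` (`A` is Jacobson). [folklore] -/
theorem isClosed_ι_of_isClosed {g : c.W} (hg : IsClosed ({g} : Set c.W)) :
    IsClosed ({c.W.ι g} : Set A.X.left) := by
  have h := c.W.ι.isOpenEmbedding.preimage_closedPoints (Y := A.X.left)
  have hg' : g ∈ closedPoints (c.W : Scheme.{u}) := hg
  rw [← h] at hg'
  exact hg'

variable {A c}

/-- **The rational point of a closed point `g ∈ W`** (`k` algebraically closed). [folklore] -/
def Qpt (g : c.W) (hg : IsClosed ({g} : Set c.W)) : A.Points k :=
  A.pointOfClosed (c.W.ι g) (isClosed_ι_of_isClosed A c hg)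

/-- Its point is `g`. [folklore] -/
@[simp] theorem pt_Qpt (g : c.W) (hg : IsClosed ({g} : Set c.W)) :
    AlgPoints.pt (Qpt g hg) = c.W.ι g :=
  A.pt_pointOfClosed _ _

/-- It lies in `W`. [folklore] -/
theorem Qpt_mem (g : c.W) (hg : IsClosed ({g} : Set c.W)) : AlgPoints.pt (Qpt g hg) ∈ c.W := by
  rw [pt_Qpt]; exact g.2

omit [IsAlgClosed k] in
/-- The point of `W` underlying `ptW Q`: it maps to `pt Q` in `A`. [folklore] -/
theorem ι_ptW_apply (Q : A.Points k) (hQ : AlgPoints.pt Q ∈ c.W) (p : ↥(Spec (.of k))) :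
    c.W.ι (ptW Q hQ p) = AlgPoints.pt Q := by
  haveI := subsingleton_Spec (k := k)
  have hp : p = IsLocalRing.closedPoint k := Subsingleton.elim _ _
  subst hp
  change (ptW Q hQ ≫ c.W.ι) _ = _
  rw [ptW_ι]
  rfl

/-- `ptW (Qpt g)` hits `g`. [folklore] -/
theorem ptW_Qpt_apply (g : c.W) (hg : IsClosed ({g} : Set c.W)) (p : ↥(Spec (.of k))) :
    ptW (Qpt g hg) (Qpt_mem g hg) p = g := by
  apply c.W.ι.isOpenEmbedding.injective
  rw [ι_ptW_apply, pt_Qpt]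

/-- The point of `W` underlying `ptW Q` is closed. [folklore] -/
theorem isClosed_ptW (Q : A.Points k) (hQ : AlgPoints.pt Q ∈ c.W) (p : ↥(Spec (.of k))) :
    IsClosed ({ptW Q hQ p} : Set c.W) := by
  have h := (pointEquivClosedPoint (fW A c) ⟨ptW Q hQ, ?_⟩).2
  · haveI := subsingleton_Spec (k := k)
    have hp : p = IsLocalRing.closedPoint k := Subsingleton.elim _ _
    subst hp
    exact h
  · change ptW Q hQ ≫ c.W.ι ≫ A.X.hom = 𝟙 _
    rw [ptW_ι_assoc]
    have := Over.w Q
    simpa only [Over.mk_hom, Algebra.algebraMap_self, CommRingCat.ofHom_id, Spec.map_id] using this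

omit [IsAlgClosed k] in
/-- `fstW (sectionAt Q x) = g`, the point of `Q`. [folklore] -/
theorem fstW_sectionAt_apply (Q : A.Points k) (hQ : AlgPoints.pt Q ∈ c.W) (x : A.X.left) :
    fstW A c (sectionAt Q hQ x) = ptW Q hQ (IsLocalRing.closedPoint k) := by
  haveI := subsingleton_Spec (k := k)
  change (sectionAt Q hQ ≫ fstW A c) x = _
  rw [sectionAt_fstW, Scheme.Hom.comp_apply]
  congr 1
  exact Subsingleton.elim _ _

omit [IsAlgClosed k] in
/-- `ρ (sectionAt Q x) = s_v x`. [folklore] -/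
theorem ρ_sectionAt_apply (Q : A.Points k) (hQ : AlgPoints.pt Q ∈ c.W) (x : A.X.left) :
    ρ A c (sectionAt Q hQ x) = sv Q hQ x := by
  change (sectionAt Q hQ ≫ ρ A c) x = _
  rw [sectionAt_ρ]

omit [IsAlgClosed k] in
/-- `act (sectionAt Q x) = t_Q x`. [folklore] -/
theorem actL_sectionAt_apply (Q : A.Points k) (hQ : AlgPoints.pt Q ∈ c.W) (x : A.X.left) :
    actL A c (sectionAt Q hQ x) = (A.translation Q).left x := by
  change (sectionAt Q hQ ≫ (act A c).left) x = _
  rw [sectionAt_act]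

omit [IsAlgClosed k] in
/-- `vpt Q` is a `k`-point of `𝔸ˢ_k`. [folklore] -/
theorem vpt_over (Q : A.Points k) (hQ : AlgPoints.pt Q ∈ c.W) :
    vpt Q hQ ≫ (𝔸(Idx A c; Spec (.of k)) ↘ Spec (.of k)) = 𝟙 _ := by
  rw [vpt, Category.assoc, toAffine_over, ptW_ι_assoc]
  have := Over.w Q
  simpa only [Over.mk_hom, Algebra.algebraMap_self, CommRingCat.ofHom_id, Spec.map_id] using this

/-- **`k`-points of `𝔸ˢ_k` with the same underlying point are equal**, hence so are the sections
`s_v`. [folklore] -/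
theorem sv_eq_of_toAffine_eq {Q Q' : A.Points k} (hQ : AlgPoints.pt Q ∈ c.W) (hQ' : AlgPoints.pt Q' ∈ c.W)
    (h : toAffine A c (ptW Q hQ (IsLocalRing.closedPoint k)) =
      toAffine A c (ptW Q' hQ' (IsLocalRing.closedPoint k))) : sv Q hQ = sv Q' hQ' := by
  have hv : vpt Q hQ = vpt Q' hQ' := by
    apply ext_of_apply_closedPoint_eq (𝔸(Idx A c; Spec (.of k)) ↘ Spec (.of k)) (vpt_over Q hQ)
      (vpt_over Q' hQ')
    change (ptW Q hQ ≫ toAffine A c) _ = (ptW Q' hQ' ≫ toAffine A c) _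
    rw [Scheme.Hom.comp_apply, Scheme.Hom.comp_apply]
    exact h
  unfold sv
  congr 1
  rw [hv]

/-- **Uniqueness of the point of `WA` over `(g, p)` for a closed `g ∈ W`**: a point `w ∈ WA` with
`fstW w = g` closed and `ρ w = s_v x` (`v = π(g)`) is `sectionAt Q_g x`. [folklore] -/
theorem eq_sectionAt_of_fstW_eq {w : WA A c} {g : c.W} (hg : IsClosed ({g} : Set c.W))
    (hw : fstW A c w = g) {x : A.X.left} (hρ : ρ A c w = sv (Qpt g hg) (Qpt_mem g hg) x) :
    w = sectionAt (Qpt g hg) (Qpt_mem g hg) x := by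
  apply pullback_ext_of_surjective_residueFieldMap
  · rw [fstW_sectionAt_apply, ptW_Qpt_apply]; exact hw
  · rw [ρ_sectionAt_apply]; exact hρ
  · rw [fstW_sectionAt_apply, ptW_Qpt_apply]
    exact surjective_residueFieldMap_of_isClosed (fW A c)
      (𝔸(Idx A c; Spec (.of k)) ↘ Spec (.of k)) (toAffine A c) (toAffine_over A c) hg

/-! ### The fibre of `π` over `v = π(g)` and the opens `⋂ t_{g'}⁻¹ U` -/

omit [IsAlgClosed k] in
/-- `toAffine` is locally quasi-finite. [folklore] -/
instance locallyQuasiFinite_toAffine : LocallyQuasiFinite (toAffine A c) := by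
  haveI := c.isFinite_π; unfold toAffine; infer_instance

omit [IsAlgClosed k] in
/-- `toAffine` is quasi-compact. [folklore] -/
instance quasiCompact_toAffine : QuasiCompact (toAffine A c) := by
  haveI := c.isFinite_π; unfold toAffine; infer_instance

section Fibre

variable (Q : A.Points k) (hQ : AlgPoints.pt Q ∈ c.W)

/-- The point `g ∈ W` of the rational point `Q`. [folklore] -/
abbrev gQ : c.W := ptW Q hQ (IsLocalRing.closedPoint k)

/-- **The fibre `π⁻¹(v)`, `v = π(g)`**, as a set of points of `W`. [folklore] -/
def fiberSet : Set c.W := (toAffine A c) ⁻¹' {toAffine A c (gQ Q hQ)}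

omit [IsAlgClosed k] in
/-- The fibre is finite (`toAffine` is quasi-finite). [folklore] -/
theorem fiberSet_finite : (fiberSet Q hQ).Finite := (toAffine A c).finite_preimage_singleton _

/-- `v = π(g)` is a closed point of `𝔸ˢ_k` (the image of a `k`-point). [folklore] -/
theorem isClosed_toAffine_gQ : IsClosed ({toAffine A c (gQ Q hQ)} : Set ↥𝔸(Idx A c; Spec (.of k))) :=
  (pointEquivClosedPoint (𝔸(Idx A c; Spec (.of k)) ↘ Spec (.of k)) ⟨vpt Q hQ, vpt_over Q hQ⟩).2

/-- **Points of the fibre are closed** (hence rational). [folklore] -/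
theorem isClosed_of_mem_fiberSet {g' : c.W} (hg' : g' ∈ fiberSet Q hQ) :
    IsClosed ({g'} : Set c.W) := by
  have hg'' : toAffine A c g' = toAffine A c (gQ Q hQ) := hg'
  refine isClosed_singleton_of_finite_fiber (toAffine A c) ?_ ?_
  · rw [hg'']; exact fiberSet_finite Q hQ
  · rw [hg'']; exact isClosed_toAffine_gQ Q hQ

/-- The translated open `t_{g'}⁻¹ U` for a closed `g' ∈ W` (and `⊤` otherwise). [folklore] -/
def tU (U : A.X.left.Opens) (g' : c.W) : A.X.left.Opens := by
  classical
  exact if hg : IsClosed ({g'} : Set c.W) then (A.translation (Qpt g' hg)).left ⁻¹ᵁ U else ⊤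

/-- `tU U g' = t_{g'}⁻¹ U` for closed `g'`. [folklore] -/
theorem tU_of_isClosed (U : A.X.left.Opens) {g' : c.W} (hg : IsClosed ({g'} : Set c.W)) :
    tU U g' = (A.translation (Qpt g' hg)).left ⁻¹ᵁ U := by
  classical
  exact dif_pos hg

/-- `t_{g'}⁻¹ U` is affine for `U` affine. [folklore] -/
theorem isAffineOpen_tU {U : A.X.left.Opens} (hU : IsAffineOpen U) {g' : c.W}
    (hg : IsClosed ({g'} : Set c.W)) : IsAffineOpen (tU U g') := by
  rw [tU_of_isClosed U hg]; exact hU.preimage_of_isIso _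

/-- Membership in a finite infimum of opens. [folklore] -/
theorem mem_finset_inf_iff {X : Scheme.{u}} {J : Type*} (s : Finset J) (f : J → X.Opens) (x : X) :
    x ∈ s.inf f ↔ ∀ i ∈ s, x ∈ f i := by
  classical
  induction s using Finset.induction_on with
  | empty => simp
  | insert a s ha ih => rw [Finset.inf_insert, Opens.mem_inf, ih]; simp

/-- A non-empty finite intersection of affine opens of a separated scheme is affine. [folklore] -/
theorem isAffineOpen_finset_inf {X : Scheme.{u}} [X.IsSeparated] {J : Type*} (s : Finset J)
    (f : J → X.Opens) (hs : s.Nonempty) (hf : ∀ i ∈ s, IsAffineOpen (f i)) :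
    IsAffineOpen (s.inf f) := by
  classical
  induction s using Finset.induction_on with
  | empty => exact absurd hs (by simp)
  | insert a s ha ih =>
    rw [Finset.inf_insert]
    by_cases hs' : s.Nonempty
    · exact (hf a (Finset.mem_insert_self a s)).inf
        (ih hs' fun i hi => hf i (Finset.mem_insert_of_mem hi))
    · rw [Finset.not_nonempty_iff_eq_empty.1 hs', Finset.inf_empty, inf_top_eq]
      exact hf a (Finset.mem_insert_self a s)

/-- **`U_v = ⋂_{g' ∈ π⁻¹(v)} t_{g'}⁻¹ U`.** [folklore] -/
def Uv (U : A.X.left.Opens) : A.X.left.Opens := (fiberSet_finite Q hQ).toFinset.inf (tU U)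

/-- Membership in `U_v`. [folklore] -/
theorem mem_Uv_iff {U : A.X.left.Opens} {x : A.X.left} :
    x ∈ Uv Q hQ U ↔ ∀ (g' : c.W) (hg' : g' ∈ fiberSet Q hQ),
      (A.translation (Qpt g' (isClosed_of_mem_fiberSet Q hQ hg'))).left x ∈ U := by
  rw [Uv, mem_finset_inf_iff]
  refine ⟨fun h g' hg' => ?_, fun h g' hg' => ?_⟩
  · have := h g' ((fiberSet_finite Q hQ).mem_toFinset.2 hg')
    rwa [tU_of_isClosed U (isClosed_of_mem_fiberSet Q hQ hg')] at this
  · have hg'' := (fiberSet_finite Q hQ).mem_toFinset.1 hg'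
    rw [tU_of_isClosed U (isClosed_of_mem_fiberSet Q hQ hg'')]
    exact h g' hg''

/-- **`U_v` is affine** for `U` affine (`A` is separated). [folklore] -/
theorem isAffineOpen_Uv {U : A.X.left.Opens} (hU : IsAffineOpen U) : IsAffineOpen (Uv Q hQ U) :=
  isAffineOpen_finset_inf _ _ ⟨gQ Q hQ, (fiberSet_finite Q hQ).mem_toFinset.2 rfl⟩
    fun _ hg' => isAffineOpen_tU hU (isClosed_of_mem_fiberSet Q hQ ((fiberSet_finite Q hQ).mem_toFinset.1 hg'))

variable (E : CartierDivisor A.X.left)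

omit [IsAlgClosed k] in
/-- `s_v(x)` lies over `D(h)`. [folklore] -/
theorem sv_mem_range_jA (x : A.X.left) : sv Q hQ x ∈ Set.range (jA A c) := by
  rw [range_jA, Set.mem_preimage, ← Scheme.Hom.comp_apply, sv_prS, Scheme.Hom.comp_apply]
  exact ⟨c.π (ptW Q hQ (A.X.hom x)), by rw [vpt, toAffine]; rfl⟩

/-- **The fibres of `Supp 𝓓` along the constant sections** (Görtz–Wedhorn II, Thm. 27.71,
Step (IV): "`Supp(𝓜(x)) = ⋃_{g ∈ π⁻¹(x)} g(Supp 𝓛) = ⋃ g(X ∖ U)`"): for an effective `E` with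
`Supp E = A ∖ U` and the swept-out divisor `𝓓` (`Supp 𝓓 = Z`), `𝓓` avoids `s_v(x)` iff
`g' · x ∈ U` for all `g' ∈ π⁻¹(v)`. [cite: GortzWedhorn2023, Thm. 27.71, proof, Step (IV) (p. 829)] -/
theorem avoids_sv_iff {U : A.X.left.Opens} (hEU : ∀ y, E.Avoids y ↔ y ∈ U) (hE : E.IsEffective)
    {𝓓 : CartierDivisor (P A c)} (h𝓓 : ∀ p, 𝓓.Avoids p ↔ p ∉ Z A c E) (x : A.X.left) :
    𝓓.Avoids (sv Q hQ x) ↔ x ∈ Uv Q hQ U := by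
  rw [h𝓓, mem_Uv_iff]
  constructor
  · intro hZ g' hg'
    have hcl := isClosed_of_mem_fiberSet Q hQ hg'
    have hsv : sv (Qpt g' hcl) (Qpt_mem g' hcl) = sv Q hQ :=
      sv_eq_of_toAffine_eq _ _ (by rw [ptW_Qpt_apply]; exact hg')
    by_contra hxU
    apply hZ
    have hw : sectionAt (Qpt g' hcl) (Qpt_mem g' hcl) x ∈ suppSet A c E := by
      intro hav
      apply hxU
      rw [← hEU, ← actL_sectionAt_apply (Qpt g' hcl) (Qpt_mem g' hcl) x]
      exact (CartierDivisor.IsEffective.avoids_pullback_iff (actL A c) hE).1 hav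
    exact subset_closure ⟨_, hw, by rw [ρ_sectionAt_apply, hsv]⟩
  · intro hU hZ
    have hmem : sv Q hQ x ∈ Z A c E ∩ Set.range (jA A c) := ⟨hZ, sv_mem_range_jA Q hQ x⟩
    rw [Z_inter_range_jA] at hmem
    obtain ⟨w, hwS, hwρ⟩ := hmem
    haveI := subsingleton_Spec (k := k)
    have hg' : fstW A c w ∈ fiberSet Q hQ := by
      change toAffine A c (fstW A c w) = toAffine A c (gQ Q hQ)
      rw [← Scheme.Hom.comp_apply, pullback.condition, Scheme.Hom.comp_apply, hwρ,
        ← Scheme.Hom.comp_apply, sv_prS, Scheme.Hom.comp_apply, vpt, Scheme.Hom.comp_apply]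
      congr 2
      exact Subsingleton.elim _ _
    have hcl := isClosed_of_mem_fiberSet Q hQ hg'
    have hsv : sv (Qpt _ hcl) (Qpt_mem _ hcl) = sv Q hQ :=
      sv_eq_of_toAffine_eq _ _ (by rw [ptW_Qpt_apply]; exact hg')
    have hw : w = sectionAt (Qpt _ hcl) (Qpt_mem _ hcl) x :=
      eq_sectionAt_of_fstW_eq hcl rfl (by rw [hsv]; exact hwρ)
    apply hwS
    rw [hw]
    apply (CartierDivisor.IsEffective.avoids_pullback_iff (actL A c) hE).2
    rw [actL_sectionAt_apply, hEU]
    exact hU _ hg'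

omit [IsAlgClosed k] in
/-- A translation fixes the generic point. [folklore] -/
theorem translation_genericPoint (R : A.Points k) :
    (A.translation R).left (genericPoint A.X.left) = genericPoint A.X.left :=
  genericPoint_eq_of_isOpenImmersion _

/-- **`𝓓` avoids `s_v(η_A)`** (all `g' · η = η ∈ U`). [folklore] -/
theorem avoids_sv_genericPoint {U : A.X.left.Opens} [Nonempty U] (hEU : ∀ y, E.Avoids y ↔ y ∈ U)
    (hE : E.IsEffective) {𝓓 : CartierDivisor (P A c)} (h𝓓 : ∀ p, 𝓓.Avoids p ↔ p ∉ Z A c E) :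
    𝓓.Avoids (sv Q hQ (genericPoint A.X.left)) := by
  rw [avoids_sv_iff Q hQ E hEU hE h𝓓, mem_Uv_iff]
  intro g' _
  rw [translation_genericPoint]
  exact (genericPoint_spec A.X.left).mem_open_set_iff U.2 |>.2
    ⟨_, Set.mem_univ _, (Classical.arbitrary U).2⟩

end Fibre

/-! ### Good sections for a closed point -/

omit [IsAlgClosed k] in
/-- `Spec k[T]_h` is integral. [folklore] -/
instance isIntegral_SpecAway : IsIntegral (Spec (CommRingCat.of (Localization.Away c.h))) := by
  haveI : IsDomain (Localization.Away c.h) :=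
    IsLocalization.isDomain_localization (powers_le_nonZeroDivisors_of_noZeroDivisors c.h_ne_zero)
  infer_instance

omit [IsAlgClosed k] in
/-- `𝔸ˢ_k` is Jacobson. [folklore] -/
instance jacobsonSpace_affineSpace : JacobsonSpace ↥𝔸(Idx A c; Spec (.of k)) :=
  LocallyOfFiniteType.jacobsonSpace (𝔸(Idx A c; Spec (.of k)) ↘ Spec (.of k))

omit [IsAlgClosed k] in
/-- `Spec k[T]_h` is Jacobson. [folklore] -/
instance jacobsonSpace_SpecAway : JacobsonSpace ↥(Spec (CommRingCat.of (Localization.Away c.h))) :=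
  .of_isOpenEmbedding (jS A c).isOpenEmbedding

/-- For a closed `g ∈ W` and a closed point `x₀ = pt P₀`: `t_{Q_g}(x₀) = t_{P₀}(g)`. [folklore] -/
theorem translation_Qpt_apply (g : c.W) (hg : IsClosed ({g} : Set c.W)) (x₀ : A.X.left)
    (hx₀ : IsClosed ({x₀} : Set A.X.left)) :
    (A.translation (Qpt g hg)).left x₀ = (A.translation (A.pointOfClosed x₀ hx₀)).left (c.W.ι g) := by
  conv_lhs => rw [← A.pt_pointOfClosed x₀ hx₀]
  rw [AbelianVariety.translation_apply_pt_comm, pt_Qpt]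

/-- **For a closed point `x₀` there is a rational point `Q ∈ W(k)` with `x₀ ∈ U_{π(Q)}`**
(Görtz–Wedhorn II, Thm. 27.71, Step (III), adapted: the image under the finite `π` of the proper
closed subset `{g ∈ W | g · x₀ ∉ U}` is a proper closed subset of `D(h)`, any closed point `q`
off it will do, `π⁻¹(q) ≠ ∅` consisting of closed points `g'` with `g' · x₀ ∈ U`).
[cite: GortzWedhorn2023, Thm. 27.71, proof, Steps (III)–(IV) (pp. 828–829)] -/
theorem exists_good_point {U : A.X.left.Opens} [Nonempty U] (x₀ : A.X.left)
    (hx₀ : IsClosed ({x₀} : Set A.X.left)) :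
    ∃ (Q : A.Points k) (hQ : AlgPoints.pt Q ∈ c.W), x₀ ∈ Uv Q hQ U := by
  set P₀ := A.pointOfClosed x₀ hx₀ with hP₀
  -- the bad locus `B = {g ∈ W | t_{P₀}(g) ∉ U}` and its image under `π`
  set B : Set c.W := {g | (A.translation P₀).left (c.W.ι g) ∉ U} with hB
  have hBc : IsClosed B := by
    have : B = (c.W.ι ≫ (A.translation P₀).left) ⁻¹' (U : Set A.X.left)ᶜ := by
      ext g; simp [hB]
    rw [this]
    exact U.2.isClosed_compl.preimage (c.W.ι ≫ (A.translation P₀).left).continuous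
  haveI := c.isFinite_π
  have hCc : IsClosed (c.π '' B) := c.π.isClosedMap _ hBc
  -- the generic point of `Spec k[T]_h` is not in `π(B)`
  have hη : genericPoint ↥(Spec (CommRingCat.of (Localization.Away c.h))) ∉ c.π '' B := by
    rintro ⟨g, hgB, hgη⟩
    have hg := eq_genericPoint_of_isFinite c.π hgη
    apply hgB
    rw [hg, genericPoint_eq_of_isOpenImmersion c.W.ι, translation_genericPoint]
    exact (genericPoint_spec A.X.left).mem_open_set_iff U.2 |>.2
      ⟨_, Set.mem_univ _, (Classical.arbitrary U).2⟩
  -- a closed point `q` off `π(B)`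
  obtain ⟨q, hqB, hqc⟩ := nonempty_inter_closedPoints (Z := (c.π '' B)ᶜ) ⟨_, hη⟩
    hCc.isOpen_compl.isLocallyClosed
  -- a (closed) point `g₀` of the fibre over `q`
  haveI := c.surjective_π
  obtain ⟨g₀, hg₀⟩ := c.π.surjective q
  have hg₀c : IsClosed ({g₀} : Set c.W) := by
    refine isClosed_singleton_of_finite_fiber c.π (c.π.finite_preimage_singleton _) ?_
    rw [hg₀]; exact hqc
  refine ⟨Qpt g₀ hg₀c, Qpt_mem g₀ hg₀c, ?_⟩
  rw [mem_Uv_iff]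
  intro g' hg'
  -- `π g' = q`, so `g' ∉ B`
  have h1 : toAffine A c g' = toAffine A c g₀ := by
    have : gQ (Qpt g₀ hg₀c) (Qpt_mem g₀ hg₀c) = g₀ := ptW_Qpt_apply g₀ hg₀c _
    rw [← this]; exact hg'
  have h2 : c.π g' = q := by
    rw [← hg₀]
    apply (jS A c).isOpenEmbedding.injective
    rw [← Scheme.Hom.comp_apply, ← Scheme.Hom.comp_apply]
    exact h1
  have h3 : g' ∉ B := fun h => hqB ⟨g', h, h2⟩
  rw [translation_Qpt_apply _ _ x₀ hx₀]
  exact not_not.1 h3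

/-! ### Ampleness and projectivity -/

/-- **Supports pull back**: for an effective `D` avoiding `g(η_Y)`, `g^*D` avoids `y` iff `D`
avoids `g(y)` (stalk maps are local). [folklore] -/
theorem avoids_pullbackAvoiding_iff {X Y : Scheme.{u}} [IsIntegral X] [IsIntegral Y] (g : Y ⟶ X)
    {D : CartierDivisor X} (hD : D.IsEffective) (h : D.Avoids (g (genericPoint Y))) (y : Y) :
    (D.pullbackAvoiding g h).Avoids y ↔ D.Avoids (g y) := by
  obtain ⟨i, hi⟩ := (D.pullbackAvoiding g h).covers y
  constructor
  · intro hav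
    exact CartierDivisor.Avoids.of_mem hi ((hD i.1 (g y) hi).isUnitAt_of_pullbackFn (hav i hi))
  · intro hD' j hj
    rw [CartierDivisor.pullbackAvoiding_f]
    exact (hD' j.1 hj).pullbackFn

/-- The pullback of an effective divisor avoiding `g(η)` along any morphism `g` is effective.
[folklore] -/
theorem isEffective_pullbackAvoiding {X Y : Scheme.{u}} [IsIntegral X] [IsIntegral Y] (g : Y ⟶ X)
    {D : CartierDivisor X} (hD : D.IsEffective) (h : D.Avoids (g (genericPoint Y))) :
    (D.pullbackAvoiding g h).IsEffective := fun i y hi => by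
  rw [CartierDivisor.pullbackAvoiding_f]
  exact (hD i.1 (g y) hi).pullbackFn

variable (A) in
/-- **An abelian variety over an algebraically closed field has an ample divisor** — without the
theorem of the square (Görtz–Wedhorn II, Thm. 27.71 for the group variety `A`, Steps (III)–(IV),
made effective with divisors): `D = s_{v₀}^* 𝓓` for the swept-out divisor `𝓓` on `𝔸ˢ_A` of a
finite flat chart; for a closed point `x₀` and a good `v`, `s_v^* 𝓓 ∼ D`
(`AffineSpaceDivisor.pullbackAvoiding_section_linEquiv`: rationally parametrised divisors are
linearly equivalent, Prop. 27.69), `x₀ ∉ Supp s_v^*𝓓` and `A ∖ Supp s_v^*𝓓 = ⋂ t_{g'}⁻¹ U` is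
affine. [cite: GortzWedhorn2023, Thm. 27.71, proof, Steps (III)–(IV) (pp. 828–829)] -/
theorem exists_isAmple_of_chart : ∃ D : CartierDivisor A.X.left, D.IsAmple := by
  haveI := A.isNoetherian_left
  -- an affine open `U ≠ ∅` and the effective divisor `E` with `Supp E = A ∖ U`
  obtain ⟨x⟩ := (inferInstance : Nonempty A.X.left)
  obtain ⟨U, hU, hxU, -⟩ := exists_isAffineOpen_mem_and_subset (U := ⊤) (Set.mem_univ x)
  haveI : Nonempty U := ⟨⟨x, hxU⟩⟩
  obtain ⟨E, hE, hEU⟩ := CartierDivisor.exists_isEffective_avoids_iff_holds (X := A.X.left)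
    A.isRegularLocalRing_stalk U hU ⟨x, hxU⟩
  -- a finite flat chart and the swept-out divisor on `𝔸ˢ_A`
  obtain ⟨c, -⟩ := exists_finiteFlatChart_le (k := k) (f := A.X.hom) ⟨U, hU⟩
  obtain ⟨𝓓, h𝓓eff, h𝓓⟩ := exists_sweptDivisor A c E hE
  -- the reference section
  obtain ⟨Q₀, hQ₀⟩ := exists_point_mem_W A c
  have h₀ := avoids_sv_genericPoint Q₀ hQ₀ E hEU hE h𝓓
  refine ⟨𝓓.pullbackAvoiding (sv Q₀ hQ₀) h₀, inferInstance, inferInstance, 1, one_pos, fun y => ?_⟩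
  -- a closed point `x₀` under `y` and a good section for it
  obtain ⟨x₀, hx₀c, hyx₀⟩ := A.exists_isClosed_specializes y
  obtain ⟨Q, hQ, hx₀⟩ := exists_good_point (U := U) x₀ hx₀c
  have h₁ := avoids_sv_genericPoint Q hQ E hEU hE h𝓓
  -- `s_v^* 𝓓 ∼ s_{v₀}^* 𝓓`
  have hlin := AffineSpaceDivisor.pullbackAvoiding_section_linEquiv
    (uniqueFactorizationMonoid_stalk_A A) 𝓓 (sv Q hQ) (sv Q₀ hQ₀) (sv_over Q hQ) (sv_over Q₀ hQ₀) h₁ h₀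
  obtain ⟨h, hh, H⟩ := (CartierDivisor.linEquiv_iff _ _).1 hlin
  have heff : (𝓓.pullbackAvoiding (sv Q hQ) h₁).IsEffective := isEffective_pullbackAvoiding _ h𝓓eff h₁
  refine ⟨1 * h⁻¹, ?_, ?_, ?_⟩
  · rw [CartierDivisor.one_smul]
    exact CartierDivisor.IsSection.of_linEquiv hh H heff.isSection_one
  · rw [CartierDivisor.one_smul, CartierDivisor.nonvanishing_mul_inv_of_linEquiv H,
      ← CartierDivisor.setOf_avoids_eq_nonvanishing]
    refine hyx₀.mem_open (AffineSpaceDivisor.isOpen_setOf_avoids _) ?_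
    change (𝓓.pullbackAvoiding (sv Q hQ) h₁).Avoids x₀
    rw [avoids_pullbackAvoiding_iff _ h𝓓eff, avoids_sv_iff Q hQ E hEU hE h𝓓]
    exact hx₀
  · have heq : ((1 : ℕ) • 𝓓.pullbackAvoiding (sv Q₀ hQ₀) h₀).nonvanishingOpens (1 * h⁻¹) = Uv Q hQ U := by
      apply Opens.ext
      change ((1 : ℕ) • 𝓓.pullbackAvoiding (sv Q₀ hQ₀) h₀).nonvanishing (1 * h⁻¹) = _
      rw [CartierDivisor.one_smul, CartierDivisor.nonvanishing_mul_inv_of_linEquiv H,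
        ← CartierDivisor.setOf_avoids_eq_nonvanishing]
      ext z
      simp only [Set.mem_setOf_eq, SetLike.mem_coe]
      rw [avoids_pullbackAvoiding_iff _ h𝓓eff, avoids_sv_iff Q hQ E hEU hE h𝓓]
    rw [heq]
    exact isAffineOpen_Uv Q hQ hU

variable (A) in
/-- **An abelian variety over an algebraically closed field is projective** (Görtz–Wedhorn II,
Prop. 27.174 / Thm. 27.71; Mumford, *Abelian Varieties*, §6, Application 1): from the ample divisor
of `exists_isAmple_of_chart` by `AbelianVariety.isProjectiveOver_of_isAmple`
(`Motives/ProjectiveOfAmpleDivisor`). [cite: GortzWedhorn2023, Prop. 27.174 (p. 880)] -/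
theorem isProjectiveOver_self : IsProjectiveOver A.X := by
  obtain ⟨D, hD⟩ := exists_isAmple_of_chart A
  exact A.isProjectiveOver_of_isAmple hD

end ChartFamily

/-- **Every abelian variety over every field is projective** (Milne, *Abelian Varieties* (1986),
Thm. 7.1; Görtz–Wedhorn II, Prop. 27.174; Mumford, *Abelian Varieties*, §6, Application 1 and §7):
the DISCHARGE of the named fact `AbelianVariety.isProjectiveOver` (`Motives/CyclesAbelianVarieties`)
— over `k̄` by the cohomology-free chart argument of Thm. 27.71 (`ChartFamily.isProjectiveOver_self`),
and descent to `k` (`isProjectiveOver_of_algebraicClosure`, Görtz–Wedhorn I, Prop. 14.57).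
[cite: GortzWedhorn2023, Thm. 27.71 (p. 827) and Prop. 27.174 (p. 880)] [cite: GortzWedhorn2020, Prop. 14.57 (p. 571)] -/
theorem AbelianVariety.isProjectiveOver_holds {k : Type u} [Field k] :
    AbelianVariety.isProjectiveOver (k := k) :=
  isProjectiveOver_of_algebraicClosure fun A => ChartFamily.isProjectiveOver_self A

namespace AbelianVariety

/-- The named fact `A.isSmoothProjective` (`Motives/AbelianVariety`) for every abelian variety over
every field: projective by `AbelianVariety.isProjectiveOver_holds`, smooth of relative dimension
`dim A` and geometrically irreducible unconditionally (`isSmoothProjective_of_isProjectiveOver`).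
[cite: GortzWedhorn2023, Prop. 27.174 (p. 880)] -/
theorem isSmoothProjective_holds {k : Type u} [Field k] {A : AbelianVariety k} : A.isSmoothProjective :=
  A.isSmoothProjective_of_isProjectiveOver (AbelianVariety.isProjectiveOver_holds A)

/-- The named fact `A.exists_isAmple_symmetric` (`Motives/AbelianVarietyDegree`) for every abelian
variety over every field: a symmetric ample divisor `H + [-1]^*H` from a projective embedding
(`exists_isAmple_symmetric_of_isProjectiveOver`, Görtz–Wedhorn II, Rem. 27.185) and
`AbelianVariety.isProjectiveOver_holds`. [cite: GortzWedhorn2023, Rem. 27.185 (p. 887)] -/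
theorem exists_isAmple_symmetric_holds {k : Type u} [Field k] {A : AbelianVariety k} :
    A.exists_isAmple_symmetric :=
  A.exists_isAmple_symmetric_of_isProjectiveOver (AbelianVariety.isProjectiveOver_holds A)

end AbelianVariety

namespace ChartFamily

end ChartFamily

end Literature.AlgebraicGeometry.Motives

end
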